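import Summits.BirchSwinnertonDyer.Rank1Residual.ManinAdditive.ALTateCohomology
import Summits.BirchSwinnertonDyer.Rank1Residual.ManinAdditive.ConwayCut
import HarnessLib
import HarnessLib.Audit.Tags

/-!
TYPER HEADER (bsd-f2-manin-ty g16, 2026-08-29; T-desc-20) — desc g15 addendum `HOME/desc/g15/Sketch-desc-g15b.lean` sha16
17a72f447bef688d landed VERBATIM (157 l.; farm rc 0 · 0 · 0 · 0 per desc, re-checked by the typer) as a NEW sibling of
`KMCuspTate.lean` (p681467; appending would push that file to 389/400 l.), with ONE bookkeeping change: namespace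
`…ManinAdditive.DescG15b` folded to `…ManinAdditive.KMCuspTateHecke` (desc: cite decls as `KMCuspTateHecke.<name>`).
CONTENT: @[conjecture] candidate rows **E-desc-99 `KMCutExponentTwoLaw`**, **E-desc-100 `KMCutALTrivialLaw`**, **E-desc-101
`KMCutUTwoContractionLaw`**, **E-desc-100♮ `KMCutNormIntegralLaw`** (bookkeeping node), **E-desc-103
`KMDefectLevelCongruenceLaw`**, **E-desc-104 `KMDefectZeroOfRationalTwoTorsion`** (redundant-by-design with E-desc-31 at
`4 ∥ N`), each an OBLIGATION NODE, nothing asserted, census counts as stated by desc (HKTALLY-g15, MEMO-desc §33.11;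
R-desc-21 (d) PENDING); PROVED edge `kmCutNormIntegralLaw_of` (E-99 ∧ E-100 ⟹ E-100♮).  HONEST FRAMING: laws of a
computational lens; prior art Edixhoven 2006 Props. 4–5 is the `p ∥ N` template only (desc's search-before-claim above);
BSD is not proved by this; Manin's conjecture is not proved by this; C2 OPEN.
-/

/-!
# desc g15 addendum (§33.11; typed as `KMCuspTateHecke`) — the quotient `L_{Q₂}/Λ` at `4 ∥ N` as a Hecke module, and where the
Lie defect `σ₂` can be non-zero (candidate rows E-desc-99 … E-desc-104; nothing asserted)

Cell bsd-f2-manin, lens -desc, MEMO-desc §33.11, data HOME/desc/g15/HKTALLY-g15.txt (engine `km_hecke.py`,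
54 levels `N = 4M ≤ 444`, 80 optimal curves).  Objects (tree declarations only): `S = integralCuspForms0 N 2`,
`L_{Q₂} = alCutLattice N 2 = S ⊓ w₄⁻¹S`, `Λ = kmCuspLattice N` (the Katz–Mazur cusp lattice = `H⁰(X₀(N)_{ℤ₍₂₎}, Ω)`
= the Néron lattice at `v₂(N) = 2`, MEMO-imc §24 / E-imc-128), `w₄ = atkinLehnerInvolutionAt N 2 2`,
`U₂ = heckeT (Gamma0 N) 2 2`, `lineIndex L f = [e_f L : ℤ f]`.

E-BLIND LAWS (54/54 levels): `2 L_{Q₂} ⊆ Λ` (E-desc-99), `(w₄ − 1) L_{Q₂} ⊆ Λ` (E-desc-100), `U₂ L_{Q₂} ⊆ Λ` (E-desc-101);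
with LAW KM-B (`[L_{Q₂} : Λ] = 2^{g(X₀(N/4))}`, `KMCuspTate.KMCuspIndexLaw`) the quotient `V = L_{Q₂}/Λ` is an
`𝔽₂`-space of dimension `g(X₀(N/4))` on which `w₄ = 1`, `U₂ = 0`, and (observation O-33.11, 49/49 levels with
`g(X₀(N/4)) > 0`) every `T_ℓ`, `ℓ` odd prime `∤ N`, has the same characteristic polynomial as on `S₂(Γ₀(N/4); ℤ) ⊗ 𝔽₂`
— the reading is `V ≅ H⁰(C₁₁, Ω¹)`, the regular differentials of the MIDDLE Katz–Mazur component `C₁₁ ≅ X₀(N/4)_{𝔽₂}`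
(a section of `ω(C₁₁)` is `½`·(a form integral at the two outer cusps)).  V is NOT generated by level-`N/4` old forms
(`L_{Q₂} ≠ Λ + (L_{Q₂} ∩ Old)`, 49/49).

E-FACING (80 optimal curves, `c_E = 1`): `ρ(f) := lineIndex L_{Q₂} f / lineIndex Λ f ∈ {1, 2}` and
`σ₂(E) := ord₂ deg φ − ord₂ lineIndex Λ f = log₂ ρ(f)` (80/80; this is E-desc-26′ `ALCutCongruenceLaw` re-confirmed on an
independent engine: `ord₂ deg φ = ord₂ lineIndex L_{Q₂} f` 80/80).  `σ₂ = 1` at 28/80 curves.  LAWS: `σ₂(E) = 1 ⟹` the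
mod-2 Hecke eigensystem of `f` away from `2` OCCURS in `S₂(Γ₀(N/4); 𝔽₂)` and is non-Eisenstein (E-desc-103, 28/28 — a
THEOREM modulo O-33.11, since `σ₂ = 1` iff the primitive `f`-functional of `Λ` is non-zero on `V`); `E(ℚ)[2] ≠ 0 ⟹ σ₂ = 0`
at `4 ∥ N` (E-desc-104, 33/33; E-desc-31 needs the torsion point in `E⁰(ℚ₂)` but covers every `4 ∣ N`).  FITTED, not typed
(σ-IFF, 43/43 non-Eisenstein curves whose system occurs at level `N/4`): `σ₂ = 1 ⟺ dim S₂(N/4; 𝔽₂)[𝔪_f] = dim H¹(⟨w₄⟩, Λ)[𝔪_f]`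
(`𝔪_f` the odd-ℓ eigen-ideal; the failing side has the level-`N/4` socle twice the new one: 92ab, 124ab, 236ab, 348a–d,
372acd, 428ab).  DEAD: «σ₂ = 1 ⟺ f ≡ a 2-supersingular level-N/4 form» (116a1, 212a1, 244a1, 316ab, 324bd, 356a1 have `T̄₂`
unipotent), «⟺ multiplicity one at level N/4» (228b1, 308a1, 396c1).

PRIOR ART (search-before-claim): Edixhoven 2006, Prop. 4–5 [corpus: paper:arxiv-math_0312019 p6 L55–59, p7 L10–22] is
the `p ∥ N` TEMPLATE of the E-blind package: the `p`-part of `S₂(ℤ)/Cot₀(J₀(N))` is killed by `p` (by `4` if `p = 2`) and its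
`p`-killed part is `H⁰(C₀, Ω¹) = 𝔽_p ⊗ S₂(Γ₀(N/p); ℤ)` with `T_n ↦ T_n` (`(n,p) = 1`), `U_p ↦ 0`; the case `p² ∣ N` is
explicitly excluded there («some computations in [Edix2] (thesis 1989), [Edix3] (Texel 1991) for p² ∥ N» — not held by
the cell).  E-desc-99/101 and O-33.11 are the `v₂(N) = 2` analogue under `S₂(ℤ) ↦ L_{Q₂}`, `C₀ ↦ C₁₁`, «killed by 4» ↦
«killed by 2»; E-desc-100 (`w₄ = 1` on the quotient) has no `p ∥ N` analogue.  Grade claim: variant-in-shape; beyond-print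
status unknown pending [Edix2]/[Edix3].

HONEST FRAMING: laws of a computational lens (exact linear algebra over ℤ and 𝔽₂ on q-expansion lattices); nothing is
asserted; BSD is not proved by this; Manin's conjecture is not proved by this; C2 OPEN.  PARTITION 0.
-/

noncomputable section

open scoped MatrixGroups ModularForm

open CongruenceSubgroup WeierstrassCurve Literature.NumberTheory.EllipticCurves.ModularForms

namespace Summit.BirchSwinnertonDyer.Rank1Residual.ManinAdditive.KMCuspTateHecke

open ALSignCongruence ALTateCohomology ConwayCut

/-! ### E-blind laws on the quotient `L_{Q₂}/Λ` at `4 ∥ N` -/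

/-- **E-desc-99 `KMCutExponentTwoLaw`** (LAW, E-blind; census 54/54 levels `N = 4M ≤ 444`, HKTALLY-g15 clause (X2)):
at `4 ∥ N`, `2·L_{Q₂} ⊆ Λ` — the two-cusp lattice is an overlattice of the Katz–Mazur (= Néron) lattice of EXPONENT 2
(its index is `2^{g(X₀(N/4))}` by `KMCuspTate.KMCuspIndexLaw`).  Mechanism: `L_{Q₂} = H⁰(𝒳, ω(C₁₁))` (forms integral at the
outer cusps `∞`, `w₄∞` may have a simple pole along the middle component `C₁₁`, which has multiplicity one), so `2L_{Q₂} ⊆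
H⁰(𝒳, ω) = Λ`.  Why it might fail: only together with the geometric description of `Λ` (THEOREM N=C, MEMO-imc §24).
Cheapest falsifier: one level `4 ∥ N` with `[L_{Q₂} : Λ]` not killed by 2 (none ≤ 444).
[cite: Edixhoven2006IntegralStructures, Prop. 4 (shape only: at `p ∥ N` the `p`-part of `S₂(ℤ)/Cot₀(J)` is killed by `p`, by `4` at `p = 2`; the `v₂(N) = 2` exponent-2 law for the two-cusp lattice is the cell's law E-desc-99, NOT in print — MEMO-desc §33.11; census 54/54)]
TYPER FRAMING (E-desc-99): lens desc; LAW (census 54/54), nothing asserted. [conjecture — cell candidate, NOT a tree fact] -/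
@[conjecture]
def KMCutExponentTwoLaw : Prop :=
  ∀ (N : ℕ) [NeZero N], 4 ∣ N → ¬ 8 ∣ N → ∀ g ∈ alCutLattice N 2, (2 : ℤ) • g ∈ kmCuspLattice N

/-- **E-desc-100 `KMCutALTrivialLaw`** (LAW, E-blind; census 54/54, HKTALLY-g15 clause (WV)): at `4 ∥ N` the Atkin–Lehner
involution `w₄` acts TRIVIALLY on `L_{Q₂}/Λ`: `w₄ g − g ∈ Λ` for every `g ∈ L_{Q₂}`.  (So `L_{Q₂}/Λ ⊆ Ĥ⁰`-side: the
`2^{g(X₀(N/4))}` classes of `Ĥ⁰(⟨w₄⟩, Λ)` (E-desc-92) are represented by `(w₄+1)`-images of half-forms.)  Mechanism: `w₄`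
restricts to the identity of the middle component `C₁₁ ≅ X₀(N/4)` of the Katz–Mazur fibre.  Why it might fail: if `w₄|C₁₁`
were the level-`N/4` Atkin–Lehner involution of a prime `q ∣ N/4` instead (then `w₄ ≠ 1` on `V` as soon as `w_q ≠ 1` on
`S₂(N/4; 𝔽₂)`); none ≤ 444.
[cite: KatzMazur1985, Thm. 13.4.7 (shape only: the three components of `X₀(N) ⊗ 𝔽₂` at `4 ∥ N` and the moduli action of `w₄`; the triviality of `w₄` on `L_{Q₂}/Λ` is the cell's law E-desc-100, NOT in print — MEMO-desc §33.11; census 54/54)]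
TYPER FRAMING (E-desc-100): lens desc; LAW (census 54/54), nothing asserted. [conjecture — cell candidate, NOT a tree fact] -/
@[conjecture]
def KMCutALTrivialLaw : Prop :=
  ∀ (N : ℕ) [NeZero N], 4 ∣ N → ¬ 8 ∣ N →
    ∀ g ∈ alCutLattice N 2, atkinLehnerInvolutionAt N 2 2 g - g ∈ kmCuspLattice N

/-- **E-desc-101 `KMCutUTwoContractionLaw`** (LAW, E-blind; census 54/54, HKTALLY-g15 clause (U2); `U₂` certified on
q-expansions at every level): at `4 ∥ N` the Hecke operator `U₂` maps the two-cusp lattice INTO the Katz–Mazur lattice,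
`U₂ L_{Q₂} ⊆ Λ` — i.e. `U₂ = 0` on `L_{Q₂}/Λ`.  This sharpens E-imc-127 `NeronConway.ConwayLatticeHeckeStableAtTwoReduced`
(`U₂Λ ⊆ Λ` up to odd index) at `v₂(N) = 2`: `U₂` contracts the index-`2^{g(X₀(N/4))}` overlattice.  Mechanism (conjectural):
on the Katz–Mazur fibre the `U₂`-correspondence moves the middle component `C₁₁` off itself, so the polar part along `C₁₁`
of a section of `ω(C₁₁)` is killed.  Why it might fail: a unit eigenvalue of `U₂` on `V ≅ S₂(N/4; 𝔽₂)^{ss}` (e.g. through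
the `2`-ordinary level-`N/4` forms) — the census says `U₂|V = 0` at all 49 levels with `g(X₀(N/4)) > 0`.  Cheapest
falsifier: D-desc-18's levels `452 ≤ 4M ≤ 1000` (one matrix identity per level).
[cite: Edixhoven2006IntegralStructures, Prop. 5 (shape only: at `p ∥ N`, `U_p` induces `0` on `S₂(ℤ)/Cot₀(J) ⊗ 𝔽_p ≅ H⁰(C₀, Ω¹)`; the `v₂(N) = 2` contraction `U₂ L_{Q₂} ⊆ Λ` is the cell's law E-desc-101, NOT in print — MEMO-desc §33.11; census 54/54)]
TYPER FRAMING (E-desc-101): lens desc; LAW (census 54/54), nothing asserted. [conjecture — cell candidate, NOT a tree fact] -/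
@[conjecture]
def KMCutUTwoContractionLaw : Prop :=
  ∀ (N : ℕ) [NeZero N], 4 ∣ N → ¬ 8 ∣ N →
    ∀ g ∈ alCutLattice N 2, heckeT (Gamma0 N) 2 2 g ∈ kmCuspLattice N

/-- **E-desc-100♮ `KMCutNormIntegralLaw`** (bookkeeping node, E-blind, 54/54 — implied by E-desc-99 ∧ E-desc-100, edge
`kmCutNormIntegralLaw_of` below): `(w₄ + 1) L_{Q₂} ⊆ Λ` at `4 ∥ N` (the `w₄`-norm of a half-form is a form).
TYPER FRAMING (E-desc-100♮): lens desc; bookkeeping node ⟸ E-99 ∧ E-100 (edge below), nothing asserted. [conjecture — cell candidate, NOT a tree fact] -/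
@[conjecture]
def KMCutNormIntegralLaw : Prop :=
  ∀ (N : ℕ) [NeZero N], 4 ∣ N → ¬ 8 ∣ N →
    ∀ g ∈ alCutLattice N 2, atkinLehnerInvolutionAt N 2 2 g + g ∈ kmCuspLattice N

/-- PROVED edge E-desc-99 ∧ E-desc-100 → E-desc-100♮. -/
theorem kmCutNormIntegralLaw_of (h99 : KMCutExponentTwoLaw) (h100 : KMCutALTrivialLaw) :
    KMCutNormIntegralLaw := by
  intro N _ h4 h8 g hg
  have h1 := h100 N h4 h8 g hg
  have h2 := h99 N h4 h8 g hg
  have : atkinLehnerInvolutionAt N 2 2 g + g = (atkinLehnerInvolutionAt N 2 2 g - g) + (2 : ℤ) • g := by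
    rw [two_zsmul]; abel
  rw [this]
  exact (kmCuspLattice N).add_mem h1 h2

/-! ### E-facing laws: where the Lie defect `σ₂ = log₂ ρ(f)` can be non-zero at `4 ∥ N` -/

/-- **E-desc-103 `KMDefectLevelCongruenceLaw`** (σ-NEC; LAW, E-facing; census 28/28 curves with `ρ = 2` among the 80
optimal curves of conductor `4M ≤ 444`; a THEOREM modulo observation O-33.11 `L_{Q₂}/Λ ≅_{𝕋} S₂(Γ₀(N/4); 𝔽₂)^{ss}`): if the
`f`-line indices of the two-cusp lattice and of the Katz–Mazur lattice differ (`ρ(f) = 2`, equivalently — given E-desc-26′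
and `c_E = 1` — the optimal parametrisation `E → J₀(N)` is NOT Lie-saturated at `2`), then the mod-2 eigensystem
`{a_ℓ(E) mod 2}_{ℓ odd, ℓ ∤ N}` OCCURS in the level-`N/4` cusp forms: there is `g ∈ S₂(Γ₀(N/4); ℤ) ∖ 2S₂(Γ₀(N/4); ℤ)` with
`T_ℓ g ≡ a_ℓ(E) g (mod 2)` for every odd prime `ℓ ∤ N`.  In particular `σ₂ = 0` whenever `g(X₀(N/4)) = 0` or `E[2]` is
"2-new".  Why it might fail: a `ρ = 2` curve whose functional meets `V` only through a non-semisimple piece on which the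
odd `T_ℓ` act with the right GENERALISED eigenvalues but no common eigenvector over level `N/4` — excluded if O-33.11 holds
for all odd `ℓ` (an eigen-functional non-zero on a module forces its system into the module's support).  Cheapest falsifier:
D-desc-18 levels `452…1000` (per curve: one kernel computation over `𝔽₂`).
[cite: Edixhoven2006IntegralStructures, Prop. 5 (shape only: `T_n ↦ T_n` on `H⁰(C₀, Ω¹) = 𝔽_p ⊗ S₂(Γ₀(N/p); ℤ)` at `p ∥ N`; the level-`N/4` occurrence law for the Lie defect at `v₂(N) = 2` is the cell's law E-desc-103, NOT in print — MEMO-desc §33.11; census 28/28)]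
TYPER FRAMING (E-desc-103): lens desc; LAW, E-facing (census 28/28), nothing asserted. [conjecture — cell candidate, NOT a tree fact] -/
@[conjecture]
def KMDefectLevelCongruenceLaw : Prop :=
  ∀ (W : WeierstrassCurve ℚ) [W.IsElliptic] [W.IsGloballyMinimal] [NeZero (W.conductorNorm ℤ)]
    [NeZero (W.conductorNorm ℤ / 4)] (D : ModularParametrizationData W (W.conductorNorm ℤ)),
    4 ∣ W.conductorNorm ℤ → ¬ 8 ∣ W.conductorNorm ℤ →
      lineIndex (alCutLattice (W.conductorNorm ℤ) 2) D.f ≠ lineIndex (kmCuspLattice (W.conductorNorm ℤ)) D.f →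
      ∃ g ∈ integralCuspForms0 (W.conductorNorm ℤ / 4) 2,
        (¬ ∃ h ∈ integralCuspForms0 (W.conductorNorm ℤ / 4) 2, g = (2 : ℤ) • h) ∧
        ∀ (ℓ : ℕ) [NeZero ℓ], ℓ.Prime → Odd ℓ → ¬ ℓ ∣ W.conductorNorm ℤ →
          ∃ h ∈ integralCuspForms0 (W.conductorNorm ℤ / 4) 2,
            heckeT (Gamma0 (W.conductorNorm ℤ / 4)) 2 ℓ g - ((W.frobeniusTrace ℓ : ℤ) : ℂ) • g = (2 : ℤ) • h

/-- **E-desc-104 `KMDefectZeroOfRationalTwoTorsion`** (σ-EIS at `4 ∥ N`; LAW, E-facing; census 33/33 optimal curves with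
`E(ℚ)[2] ≠ 0` of conductor `4M ≤ 444`, all with `ρ(f) = 1`): at `4 ∥ N` a rational 2-torsion point forces
`lineIndex L_{Q₂} f = lineIndex Λ f`, i.e. `σ₂(E) = 0` (with E-desc-26′ and the GIVEN row: `2 ∤ c_E` AND Lie-saturation at
2).  Relation to the tree: E-desc-31 `ConwayCut.ConwayFullOfIdentityComponentTorsion` needs the torsion point inside
`E⁰(ℚ₂)` but holds at every `4 ∣ N`; its docstring records that «torsion only through `Φ₂`» SPLITS at `8 ∣ N` (56b1, 120b1
have `σ = 1`) — this row bets that at `v₂(N) = 2` it does not split.  Why it might fail: exactly that — a `4 ∥ N` analogue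
of 56b1 (torsion point in `2Φ₂`-position) beyond 444.  Cheapest falsifier: D-desc-18 levels `452…1000` × Cremona torsion.
[cite: CesnaviciusNeururerSaha2023, Thm. 1.2 (shape only: Manin at `2` via the Néron lattice; this row restates the cell's E-desc-31 at `4 ∥ N` without the modular degree — MEMO-desc §33.11; census 33/33)]
TYPER FRAMING (E-desc-104): lens desc; LAW, E-facing (census 33/33), redundant-by-design with E-desc-31, nothing asserted. [conjecture — cell candidate, NOT a tree fact] -/
@[conjecture]
def KMDefectZeroOfRationalTwoTorsion : Prop :=
  ∀ (W : WeierstrassCurve ℚ) [W.IsElliptic] [NeZero (W.conductorNorm ℤ)]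
    (D : ModularParametrizationData W (W.conductorNorm ℤ)),
    4 ∣ W.conductorNorm ℤ → ¬ 8 ∣ W.conductorNorm ℤ →
      (∃ P : W.toAffine.Point, P ≠ 0 ∧ (2 : ℕ) • P = 0) →
      lineIndex (alCutLattice (W.conductorNorm ℤ) 2) D.f = lineIndex (kmCuspLattice (W.conductorNorm ℤ)) D.f

end Summit.BirchSwinnertonDyer.Rank1Residual.ManinAdditive.KMCuspTateHecke

end
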